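import Literature.Probability.RandomPlanarGeometry.SLESameSideMartingale
import Literature.Probability.RandomPlanarGeometry.CritPercSLEFlowProofs
import HarnessLib

/-!
# The three-point real SLE_κ flow behind Cardy's observable: pathwise facts and the level stopping time

Topic `Probability/RandomPlanarGeometry`; theorems (and two auxiliary real-valued definitions)
only. First proof file towards the named fact
`Literature.Probability.RandomPlanarGeometry.isLocalMartingale_stoppedProcess_cardyObservable_iff`
(**crit-perc.S22**, `SLEMartingale`: the Cardy observable `F(η_t)` of the SLE_κ Loewner flow with
marks `0 = W₀ < x₀ < x₁ < x₂` is a local martingale iff `κ = 6`; Werner (2007), §3;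
Lawler–Schramm–Werner (2001), §3; Lawler (2005), §6.7).

Write `Xⁱ_t = g_t(xᵢ) - W_t` for the frozen real flows (`sleRealFlowStop κ (x i)`) of the three
marks. Before the swallowing time `T = T_{x₀}` of the first mark one has `0 < X⁰ < X¹ < X²`, the
gaps `Xʲ - Xⁱ = (xⱼ - xᵢ) + ∫₀ᵗ (2/Xʲ - 2/Xⁱ) ds` are of finite variation and decrease, and Cardy's
cross-ratio is the rational function
`η_t = crossRatio (W_t, g_t(x₀), g_t(x₁), g_t(x₂)) = X⁰ (X² - X¹) / (X¹ (X² - X⁰))`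
(`cardyEta`, `cardyCrossRatio_eq_cardyEta`) of the three flows. The **level stopping time**
`cardyLevelTime κ x m M d` is the first exit of `X⁰` from `(m, M)` or of one of the gaps
`X¹ - X⁰`, `X² - X¹` from `(d, x₂ - x₀ + 1)`; up to it all the quantities entering the Itô
computation of `dF(η_t)` are bounded (`cardyLevel_bounds_of_le`), and it is reached strictly
before `T` when `T < ∞`.

## References

* W. Werner, *Lectures on two-dimensional critical percolation*, IAS/Park City (2007),
  arXiv:0710.0856, §3.
* G. F. Lawler, *Conformally Invariant Processes in the Plane*, AMS (2005), §4.1, §6.7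
  (proof of Prop. 6.33).
* G. Lawler, O. Schramm, W. Werner, *Values of Brownian intersection exponents I*, Acta Math. 187
  (2001), §3.
-/

noncomputable section

open MeasureTheory ProbabilityTheory Filter Set Topology
open scoped NNReal ENNReal

namespace Literature.Probability.RandomPlanarGeometry

open Loewner Literature.Probability.Process Literature.Analysis.FunctionSpaces

/-! ### Cardy's cross-ratio as a function of the three flows -/

/-- **Cardy's cross-ratio in flow coordinates**: for the marked tuple `(W, g(x₀), g(x₁), g(x₂))`
with `Xⁱ = g(xᵢ) - W`, `crossRatio = X⁰ (X² - X¹) / (X¹ (X² - X⁰))` (translation invariance of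
the cross-ratio). Junk value (division by zero) when `X¹ (X² - X⁰) = 0`.
[cite: Werner2007, §3] -/
def cardyEta (a b c : ℝ) : ℝ :=
  a * (c - b) / (b * (c - a))

/-- Unfolding of `cardyEta`. [folklore] -/
theorem cardyEta_apply (a b c : ℝ) : cardyEta a b c = a * (c - b) / (b * (c - a)) := rfl

/-- The cross-ratio of `(W, W + a, W + b, W + c)` is `cardyEta a b c`. [folklore] -/
theorem crossRatio_eq_cardyEta (W a b c : ℝ) :
    crossRatio ![W, W + a, W + b, W + c] = cardyEta a b c := by
  simp only [crossRatio, cardyEta, Matrix.cons_val_zero, Matrix.cons_val_one, Matrix.cons_val]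
  have h1 : (W - (W + a)) * (W + b - (W + c)) = a * (c - b) := by ring
  have h2 : (W - (W + b)) * (W + a - (W + c)) = b * (c - a) := by ring
  rw [h1, h2]

/-- For `0 < a < b < c`, `cardyEta a b c ∈ (0, 1)`. [folklore] -/
theorem cardyEta_mem_Ioo {a b c : ℝ} (ha : 0 < a) (hab : a < b) (hbc : b < c) :
    cardyEta a b c ∈ Ioo 0 1 := by
  unfold cardyEta
  have hb : 0 < b := ha.trans hab
  have hd : 0 < b * (c - a) := mul_pos hb (by linarith)
  refine ⟨div_pos (mul_pos ha (by linarith)) hd, (div_lt_one hd).2 ?_⟩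
  nlinarith

/-- `1 - cardyEta a b c = c (b - a) / (b (c - a))` (when the denominator is nonzero). [folklore] -/
theorem one_sub_cardyEta {a b c : ℝ} (hb : b ≠ 0) (hca : c - a ≠ 0) :
    1 - cardyEta a b c = c * (b - a) / (b * (c - a)) := by
  unfold cardyEta
  field_simp
  ring

/-- `(1 - η)/η = c (b - a) / (a (c - b))` for `η = cardyEta a b c` (nondegenerate tuple).
[folklore] -/
theorem one_sub_cardyEta_div {a b c : ℝ} (ha : a ≠ 0) (hb : b ≠ 0) (hca : c - a ≠ 0)
    (hcb : c - b ≠ 0) :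
    (1 - cardyEta a b c) / cardyEta a b c = c * (b - a) / (a * (c - b)) := by
  rw [one_sub_cardyEta hb hca, cardyEta]
  field_simp

/-! ### The three frozen flows before the swallowing time of the first mark -/

section Flow

variable {κ : ℝ≥0} {x : Fin 3 → ℝ}

/-- For strictly increasing positive marks, `0 < x i` and `x i ≠ 0`. [folklore] -/
theorem marks_pos (hx : StrictMono x) (hx0 : 0 < x 0) (i : Fin 3) : 0 < x i :=
  hx0.trans_le (hx.monotone (Fin.zero_le i))

/-- `x 0 < x 1`. [folklore] -/
theorem marks_zero_lt_one (hx : StrictMono x) : x 0 < x 1 := hx (by decide)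

/-- `x 1 < x 2`. [folklore] -/
theorem marks_one_lt_two (hx : StrictMono x) : x 1 < x 2 := hx (by decide)

/-- `x 0 < x 2`. [folklore] -/
theorem marks_zero_lt_two (hx : StrictMono x) : x 0 < x 2 := hx (by decide)

/-- **The three flows before `T_{x₀}`**: for `t < T_{x₀}` one has `0 < X⁰_t < X¹_t < X²_t`, and the
two gaps in integrated form `X¹ - X⁰ = (x₁ - x₀) + ∫₀ᵗ (2/X¹ - 2/X⁰) ds`,
`X² - X¹ = (x₂ - x₁) + ∫₀ᵗ (2/X² - 2/X¹) ds` (real points on the same side are swallowed in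
increasing order and keep their order; the driving function cancels in the gaps).
Lawler (2005), §4.1 and proof of Prop. 6.33. [cite: Lawler2005, Prop. 6.33] -/
theorem sleRealFlowStop_three_facts (hx : StrictMono x) (hx0 : 0 < x 0) {ω : ℝ≥0 → ℝ} {t : ℝ≥0}
    (ht : (t : WithTop ℝ≥0) < swallowingTime (sleDriving κ ω) (x 0)) :
    0 < sleRealFlowStop κ (x 0) t ω ∧
      sleRealFlowStop κ (x 0) t ω < sleRealFlowStop κ (x 1) t ω ∧
      sleRealFlowStop κ (x 1) t ω < sleRealFlowStop κ (x 2) t ω ∧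
      sleRealFlowStop κ (x 1) t ω - sleRealFlowStop κ (x 0) t ω = (x 1 - x 0) +
        ∫ s in (0 : ℝ)..t, (2 / sleRealFlowStop κ (x 1) s.toNNReal ω -
          2 / sleRealFlowStop κ (x 0) s.toNNReal ω) ∧
      sleRealFlowStop κ (x 2) t ω - sleRealFlowStop κ (x 1) t ω = (x 2 - x 1) +
        ∫ s in (0 : ℝ)..t, (2 / sleRealFlowStop κ (x 2) s.toNNReal ω -
          2 / sleRealFlowStop κ (x 1) s.toNNReal ω) := by
  have hW : Continuous (sleDriving κ ω) := continuous_sleDriving κ ω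
  have h00 : sleDriving κ ω 0 < x 0 := by rw [sleDriving_zero]; exact hx0
  have ht1 : (t : WithTop ℝ≥0) < swallowingTime (sleDriving κ ω) (x 1) :=
    lt_of_lt_of_le ht (swallowingTime_mono_right hW h00 (marks_zero_lt_one hx).le)
  obtain ⟨h0, h01, hgap01⟩ := sleRealFlowStop_sameSide_facts (κ := κ) hx0 (marks_zero_lt_one hx) ht
  obtain ⟨-, h12, hgap12⟩ :=
    sleRealFlowStop_sameSide_facts (κ := κ) (marks_pos hx hx0 1) (marks_one_lt_two hx) ht1
  exact ⟨h0, h01, h12, hgap01, hgap12⟩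

/-- Before `T_{x₀}` the gap `X¹ - X⁰` is at most its initial value `x₁ - x₀` (its time derivative
`2/X¹ - 2/X⁰` is negative). [cite: Lawler2005, Prop. 6.33] -/
theorem sleRealFlowStop_gap01_le (hx : StrictMono x) (hx0 : 0 < x 0) {ω : ℝ≥0 → ℝ} {t : ℝ≥0}
    (ht : (t : WithTop ℝ≥0) < swallowingTime (sleDriving κ ω) (x 0)) :
    sleRealFlowStop κ (x 1) t ω - sleRealFlowStop κ (x 0) t ω ≤ x 1 - x 0 := by
  obtain ⟨-, -, -, hgap, -⟩ := sleRealFlowStop_three_facts (κ := κ) hx hx0 ht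
  rw [hgap, add_le_iff_nonpos_right, intervalIntegral.integral_of_le t.coe_nonneg]
  refine setIntegral_nonpos measurableSet_Ioc fun s hs ↦ ?_
  have hs' : ((s.toNNReal : ℝ≥0) : WithTop ℝ≥0) < swallowingTime (sleDriving κ ω) (x 0) :=
    lt_of_le_of_lt (WithTop.coe_le_coe.2 (Real.toNNReal_le_iff_le_coe.2 hs.2)) ht
  obtain ⟨h0, h01, -, -, -⟩ := sleRealFlowStop_three_facts (κ := κ) hx hx0 hs'
  rw [sub_nonpos]
  exact div_le_div_of_nonneg_left zero_le_two h0 h01.le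

/-- Before `T_{x₀}` the gap `X² - X¹` is at most its initial value `x₂ - x₁`.
[cite: Lawler2005, Prop. 6.33] -/
theorem sleRealFlowStop_gap12_le (hx : StrictMono x) (hx0 : 0 < x 0) {ω : ℝ≥0 → ℝ} {t : ℝ≥0}
    (ht : (t : WithTop ℝ≥0) < swallowingTime (sleDriving κ ω) (x 0)) :
    sleRealFlowStop κ (x 2) t ω - sleRealFlowStop κ (x 1) t ω ≤ x 2 - x 1 := by
  obtain ⟨-, -, -, -, hgap⟩ := sleRealFlowStop_three_facts (κ := κ) hx hx0 ht
  rw [hgap, add_le_iff_nonpos_right, intervalIntegral.integral_of_le t.coe_nonneg]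
  refine setIntegral_nonpos measurableSet_Ioc fun s hs ↦ ?_
  have hs' : ((s.toNNReal : ℝ≥0) : WithTop ℝ≥0) < swallowingTime (sleDriving κ ω) (x 0) :=
    lt_of_le_of_lt (WithTop.coe_le_coe.2 (Real.toNNReal_le_iff_le_coe.2 hs.2)) ht
  obtain ⟨h0, h01, h12, -, -⟩ := sleRealFlowStop_three_facts (κ := κ) hx hx0 hs'
  rw [sub_nonpos]
  exact div_le_div_of_nonneg_left zero_le_two (h0.trans h01) h12.le

/-- **Cardy's cross-ratio process in flow coordinates**: before the first swallowing time of the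
marks (`swallowingStoppingTime κ x = T_{x₀}`),
`cardyCrossRatio κ x t ω = cardyEta X⁰_t X¹_t X²_t` with `Xⁱ = sleRealFlowStop κ (x i)`.
[cite: Werner2007, §3] -/
theorem cardyCrossRatio_eq_cardyEta {ω : ℝ≥0 → ℝ} {t : ℝ≥0}
    (ht : (t : WithTop ℝ≥0) < swallowingStoppingTime κ x ω) :
    cardyCrossRatio κ x t ω = cardyEta (sleRealFlowStop κ (x 0) t ω) (sleRealFlowStop κ (x 1) t ω)
      (sleRealFlowStop κ (x 2) t ω) := by
  have hti : ∀ i, (t : WithTop ℝ≥0) < swallowingTime (sleDriving κ ω) (x i) := fun i ↦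
    lt_of_lt_of_le ht (swallowingStoppingTime_le_swallowingTime κ x ω i)
  have hflow : ∀ i, sleRealFlowStop κ (x i) t ω = (sleMap κ ω t (x i)).re - sleDriving κ ω t := by
    intro i
    rw [sleRealFlowStop_apply, realFlowStop_of_lt (hti i), realFlow_apply]
    rfl
  have hvec : (![sleDriving κ ω t, (sleMap κ ω t (x 0)).re, (sleMap κ ω t (x 1)).re,
      (sleMap κ ω t (x 2)).re] : Fin 4 → ℝ) =
      ![sleDriving κ ω t, sleDriving κ ω t + sleRealFlowStop κ (x 0) t ω,
        sleDriving κ ω t + sleRealFlowStop κ (x 1) t ω,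
        sleDriving κ ω t + sleRealFlowStop κ (x 2) t ω] := by
    rw [hflow 0, hflow 1, hflow 2]
    ext i
    fin_cases i <;> simp
  rw [cardyCrossRatio, hvec, crossRatio_eq_cardyEta]

/-- Before the first swallowing time of the marks the Cardy observable is
`F(cardyEta X⁰_t X¹_t X²_t)`. [cite: Werner2007, §3] -/
theorem cardyObservable_eq_cardyFunction_cardyEta
    {ω : ℝ≥0 → ℝ} {t : ℝ≥0} (ht : (t : WithTop ℝ≥0) < swallowingStoppingTime κ x ω) :
    cardyObservable κ x t ω = cardyFunction (cardyEta (sleRealFlowStop κ (x 0) t ω)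
      (sleRealFlowStop κ (x 1) t ω) (sleRealFlowStop κ (x 2) t ω)) := by
  rw [cardyObservable_of_lt ht, cardyCrossRatio_eq_cardyEta ht]

/-- A positive value of `X⁰` can only occur before `T = T_{x₀}`, the first swallowing time of the
marks. [folklore] -/
theorem coe_lt_swallowingStoppingTime_of_pos (hx : StrictMono x) (hx0 : 0 < x 0) {ω : ℝ≥0 → ℝ}
    {t : ℝ≥0} (h : 0 < sleRealFlowStop κ (x 0) t ω) :
    (t : WithTop ℝ≥0) < swallowingStoppingTime κ x ω := by
  rw [swallowingStoppingTime_eq_holds hx hx0 ω]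
  exact coe_lt_swallowingTime_of_realFlowStop_ne_zero (W := sleDriving κ ω)
    (by rw [← sleRealFlowStop_apply]; exact h.ne')

end Flow

/-! ### The level stopping time -/

section Level

variable (κ : ℝ≥0) (x : Fin 3 → ℝ) (m M d : ℝ)

/-- **The level stopping time** of the three-point flow: the first exit of `X⁰` from `(m, M)`, or
of the gap `X¹ - X⁰` or the gap `X² - X¹` from `(d, x₂ - x₀ + 1)` (the upper gap level is never
reached before `T`, the gaps being at most `x₁ - x₀`, `x₂ - x₁`). Up to it the three flows, their
inverses and the inverses of the gaps are bounded; as `m, d ↓ 0`, `M ↑ ∞` it increases to the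
swallowing time `T_{x₀}`. (The localisation "up to `T = T(a', b')`" of Werner (2007), §3, made
quantitative.) [cite: Werner2007, §3] -/
def cardyLevelTime (ω : ℝ≥0 → ℝ) : WithTop ℝ≥0 :=
  min (Process.exitTime (sleRealFlowStop κ (x 0)) m M ω)
    (min (Process.exitTime (fun t ω ↦ sleRealFlowStop κ (x 1) t ω - sleRealFlowStop κ (x 0) t ω)
        d (x 2 - x 0 + 1) ω)
      (Process.exitTime (fun t ω ↦ sleRealFlowStop κ (x 2) t ω - sleRealFlowStop κ (x 1) t ω)
        d (x 2 - x 0 + 1) ω))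

variable {κ x m M d}

/-- `ρ ≤` the exit time of `X⁰` from `(m, M)`. [folklore] -/
theorem cardyLevelTime_le_exitTime₀ (ω : ℝ≥0 → ℝ) :
    cardyLevelTime κ x m M d ω ≤ Process.exitTime (sleRealFlowStop κ (x 0)) m M ω :=
  min_le_left _ _

/-- `ρ ≤` the exit time of the gap `X¹ - X⁰` from `(d, x₂ - x₀ + 1)`. [folklore] -/
theorem cardyLevelTime_le_exitTime₀₁ (ω : ℝ≥0 → ℝ) :
    cardyLevelTime κ x m M d ω ≤ Process.exitTime
      (fun t ω ↦ sleRealFlowStop κ (x 1) t ω - sleRealFlowStop κ (x 0) t ω) d (x 2 - x 0 + 1) ω :=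
  (min_le_right _ _).trans (min_le_left _ _)

/-- `ρ ≤` the exit time of the gap `X² - X¹` from `(d, x₂ - x₀ + 1)`. [folklore] -/
theorem cardyLevelTime_le_exitTime₁₂ (ω : ℝ≥0 → ℝ) :
    cardyLevelTime κ x m M d ω ≤ Process.exitTime
      (fun t ω ↦ sleRealFlowStop κ (x 2) t ω - sleRealFlowStop κ (x 1) t ω) d (x 2 - x 0 + 1) ω :=
  (min_le_right _ _).trans (min_le_right _ _)

section Facts

variable (hx : StrictMono x) (hx0 : 0 < x 0) (hm : 0 < m) (hmx : m < x 0) (hxM : x 0 < M)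
  (hd : 0 < d) (hd₁ : d < x 1 - x 0) (hd₂ : d < x 2 - x 1)
include hx hx0

/-- The gap processes have continuous paths. [folklore] -/
theorem continuous_gap (i j : Fin 3) (ω : ℝ≥0 → ℝ) :
    Continuous fun t ↦ sleRealFlowStop κ (x j) t ω - sleRealFlowStop κ (x i) t ω :=
  (continuous_sleRealFlowStop (marks_pos hx hx0 j).ne' ω).sub
    (continuous_sleRealFlowStop (marks_pos hx hx0 i).ne' ω)

/-- The gap processes are adapted to the raw Brownian filtration. [folklore] -/
theorem adapted_gap (i j : Fin 3) :
    Adapted brownianFiltration fun t ω ↦ sleRealFlowStop κ (x j) t ω - sleRealFlowStop κ (x i) t ω :=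
  fun t ↦ (adapted_sleRealFlowStop κ (marks_pos hx hx0 j).ne' t).sub
    (adapted_sleRealFlowStop κ (marks_pos hx hx0 i).ne' t)

/-- **The level stopping time is a stopping time** of the raw Brownian filtration (minimum of
three exit times of continuous adapted processes). [folklore] -/
theorem isStoppingTime_cardyLevelTime (m M d : ℝ) :
    IsStoppingTime brownianFiltration (cardyLevelTime κ x m M d) :=
  (isStoppingTime_exitTime_sleRealFlowStop κ hx0 m M).min
    ((Process.isStoppingTime_exitTime (adapted_gap hx hx0 0 1) (continuous_gap hx hx0 0 1)).min
      (Process.isStoppingTime_exitTime (adapted_gap hx hx0 1 2) (continuous_gap hx hx0 1 2)))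

include hm hmx hxM hd hd₁ hd₂ in
/-- **Bounds up to the level stopping time.** For `t ≤ ρ`: `t < T` (the first swallowing time
of the marks), `m ≤ X⁰_t ≤ M`, `d ≤ X¹_t - X⁰_t ≤ x₁ - x₀`, `d ≤ X²_t - X¹_t ≤ x₂ - x₁`, and
`0 < X⁰_t < X¹_t < X²_t`. [cite: Werner2007, §3] -/
theorem cardyLevel_bounds_of_le {ω : ℝ≥0 → ℝ} {t : ℝ≥0}
    (ht : (t : WithTop ℝ≥0) ≤ cardyLevelTime κ x m M d ω) :
    (t : WithTop ℝ≥0) < swallowingStoppingTime κ x ω ∧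
      sleRealFlowStop κ (x 0) t ω ∈ Icc m M ∧
      sleRealFlowStop κ (x 1) t ω - sleRealFlowStop κ (x 0) t ω ∈ Icc d (x 1 - x 0) ∧
      sleRealFlowStop κ (x 2) t ω - sleRealFlowStop κ (x 1) t ω ∈ Icc d (x 2 - x 1) ∧
      0 < sleRealFlowStop κ (x 0) t ω ∧
      sleRealFlowStop κ (x 0) t ω < sleRealFlowStop κ (x 1) t ω ∧
      sleRealFlowStop κ (x 1) t ω < sleRealFlowStop κ (x 2) t ω := by
  have hX0mem : sleRealFlowStop κ (x 0) t ω ∈ Icc m M :=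
    sleRealFlowStop_mem_Icc_of_le hx0 hmx hxM (cardyLevelTime_le_exitTime₀ ω) ht
  have hpos : 0 < sleRealFlowStop κ (x 0) t ω := hm.trans_le hX0mem.1
  have hT : (t : WithTop ℝ≥0) < swallowingStoppingTime κ x ω :=
    coe_lt_swallowingStoppingTime_of_pos hx hx0 hpos
  have hT0 : (t : WithTop ℝ≥0) < swallowingTime (sleDriving κ ω) (x 0) := by
    rwa [swallowingStoppingTime_eq_holds hx hx0 ω] at hT
  obtain ⟨-, h01, h12, -, -⟩ := sleRealFlowStop_three_facts (κ := κ) hx hx0 hT0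
  have hB₁ : x 1 - x 0 < x 2 - x 0 + 1 := by linarith [marks_one_lt_two hx]
  have hB₂ : x 2 - x 1 < x 2 - x 0 + 1 := by linarith [marks_zero_lt_one hx]
  have hg01 := stoppedProcess_mem_Icc_of_le_exitTime (ρ := cardyLevelTime κ x m M d)
    (continuous_gap (κ := κ) hx hx0 0 1 ω)
    (by simp only [sleRealFlowStop_zero_apply (marks_pos hx hx0 1).ne',
        sleRealFlowStop_zero_apply (marks_pos hx hx0 0).ne']; exact ⟨hd₁, hB₁⟩)
    (cardyLevelTime_le_exitTime₀₁ ω) t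
  have hg12 := stoppedProcess_mem_Icc_of_le_exitTime (ρ := cardyLevelTime κ x m M d)
    (continuous_gap (κ := κ) hx hx0 1 2 ω)
    (by simp only [sleRealFlowStop_zero_apply (marks_pos hx hx0 2).ne',
        sleRealFlowStop_zero_apply (marks_pos hx hx0 1).ne']; exact ⟨hd₂, hB₂⟩)
    (cardyLevelTime_le_exitTime₁₂ ω) t
  rw [stoppedProcess_eq_of_le ht] at hg01 hg12
  exact ⟨hT, hX0mem, ⟨hg01.1, sleRealFlowStop_gap01_le hx hx0 hT0⟩,
    ⟨hg12.1, sleRealFlowStop_gap12_le hx hx0 hT0⟩, hpos, h01, h12⟩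

include hmx hxM hd₁ hd₂ in
/-- The level stopping time is positive (all three processes start strictly inside their
intervals). [folklore] -/
theorem cardyLevelTime_pos (ω : ℝ≥0 → ℝ) : 0 < cardyLevelTime κ x m M d ω := by
  have hB₁ : x 1 - x 0 < x 2 - x 0 + 1 := by linarith [marks_one_lt_two hx]
  have hB₂ : x 2 - x 1 < x 2 - x 0 + 1 := by linarith [marks_zero_lt_one hx]
  refine lt_min ?_ (lt_min ?_ ?_)
  · exact exitTime_pos (continuous_sleRealFlowStop hx0.ne' ω)
      (by rw [sleRealFlowStop_zero_apply hx0.ne']; exact ⟨hmx, hxM⟩)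
  · exact exitTime_pos (continuous_gap (κ := κ) hx hx0 0 1 ω)
      (by simp only [sleRealFlowStop_zero_apply (marks_pos hx hx0 1).ne',
          sleRealFlowStop_zero_apply (marks_pos hx hx0 0).ne']; exact ⟨hd₁, hB₁⟩)
  · exact exitTime_pos (continuous_gap (κ := κ) hx hx0 1 2 ω)
      (by simp only [sleRealFlowStop_zero_apply (marks_pos hx hx0 2).ne',
          sleRealFlowStop_zero_apply (marks_pos hx hx0 1).ne']; exact ⟨hd₂, hB₂⟩)

include hm hmx in
/-- **The level stopping time is reached strictly before the first swallowing time of the marks**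
when the latter is finite: `X⁰` is continuous with `X⁰_T = 0 < m < X⁰_0`, so it passes the level
`m` before `T`. [folklore] -/
theorem cardyLevelTime_lt_swallowingStoppingTime {ω : ℝ≥0 → ℝ}
    (hT : swallowingStoppingTime κ x ω ≠ ⊤) :
    cardyLevelTime κ x m M d ω < swallowingStoppingTime κ x ω := by
  obtain ⟨T, hTeq⟩ := WithTop.ne_top_iff_exists.1 hT
  refine lt_of_le_of_lt (cardyLevelTime_le_exitTime₀ ω) ?_
  -- `X⁰_T = 0`, so by the intermediate value theorem `X⁰ = m` at some `s ≤ T`, and `s < T`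
  have hXT : sleRealFlowStop κ (x 0) T ω = 0 := by
    rw [sleRealFlowStop_apply, realFlowStop_of_le]
    rw [← swallowingStoppingTime_eq_holds hx hx0 ω, ← hTeq]
  have hX0 : sleRealFlowStop κ (x 0) 0 ω = x 0 := sleRealFlowStop_zero_apply hx0.ne' ω
  have hcont : ContinuousOn (fun t ↦ sleRealFlowStop κ (x 0) t ω) (Icc 0 T) :=
    (continuous_sleRealFlowStop hx0.ne' ω).continuousOn
  have hmem : m ∈ Icc (sleRealFlowStop κ (x 0) T ω) (sleRealFlowStop κ (x 0) 0 ω) := by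
    rw [hXT, hX0]; exact ⟨hm.le, hmx.le⟩
  obtain ⟨s, hs, hsm⟩ := intermediate_value_Icc' bot_le hcont hmem
  simp only at hsm
  have hsT : s < T := by
    rcases hs.2.lt_or_eq with h | h
    · exact h
    · exfalso
      rw [h, hXT] at hsm
      exact hm.ne' hsm.symm
  have hexit : Process.exitTime (sleRealFlowStop κ (x 0)) m M ω ≤ s := by
    rw [exitTime_le_coe_iff (continuous_sleRealFlowStop hx0.ne' ω)]
    exact ⟨s, le_rfl, fun h ↦ lt_irrefl _ (hsm ▸ h.1)⟩
  calc Process.exitTime (sleRealFlowStop κ (x 0)) m M ω ≤ s := hexit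
    _ < T := WithTop.coe_lt_coe.2 hsT
    _ = swallowingStoppingTime κ x ω := hTeq

include hm hmx in
/-- The level stopping time is at most the first swallowing time of the marks. [folklore] -/
theorem cardyLevelTime_le_swallowingStoppingTime (ω : ℝ≥0 → ℝ) :
    cardyLevelTime κ x m M d ω ≤ swallowingStoppingTime κ x ω := by
  by_cases hT : swallowingStoppingTime κ x ω = ⊤
  · rw [hT]; exact le_top
  · exact (cardyLevelTime_lt_swallowingStoppingTime hx hx0 hm hmx hT).le

end Facts

end Level

end Literature.Probability.RandomPlanarGeometry
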